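import Summits.HodgeConjecture.HodgeConjecture.Theses.PadicSemiregularLift
import Summits.HodgeConjecture.HodgeConjecture.Theorems.HodgeFermatVarieties.Negative.DegreeZeroVacuous
import Summits.HodgeConjecture.HodgeConjecture.Theorems.PadicSemiregularLiftHodgeFermatVarietiesStubEigenspacePham
import Summits.HodgeConjecture.HodgeConjecture.Theorems.PadicSemiregularLiftHodgeFermatVarietiesPairedOfLargePrimesSharp
import Literature.AlgebraicGeometry.HodgeTheory.FermatHodgeConjectureAokiProofs
import Literature.AlgebraicGeometry.HodgeTheory.ShiodaClaimPairedOfJuxtaposition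
import Literature.AlgebraicGeometry.HodgeTheory.FermatHodgeCharacters
import Literature.AlgebraicGeometry.HodgeTheory.FermatClaimShiodaSpine
import Literature.AlgebraicGeometry.HodgeTheory.ComplexConjugationHolds
import HarnessLib

/-!
# HC for the complex Fermat varieties `Xⁿₘ` whose degree has all prime factors `> n + 1` — line `cancel-by-any-claim-lattice`, crux `HodgeFermatVarieties` (stmt-HodgeConjecture-1334)

Helper file (`--supports stmt-HodgeConjecture-1334`) extracting from the skeleton of line
`cancel-by-any-claim-lattice` its ENGINE-FREE, LEVEL-MAP-FREE pay-off as a standalone, sorry-free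
theorem other routes can import. The crux is

    ∀ n m X, IsFermatVariety n m X → IsSmoothProjective n X → HodgeConjectureFor n X.

PROVED here, unconditionally:

* `hodgeConjectureFor_fermat_odd` — **HC for every ODD-dimensional Fermat variety** (every rational
  `(p,p)`-class has `2p ≠ n` and is algebraic by the Lefschetz hyperplane theorem for smooth
  hypersurfaces, DISCHARGED in the tree: `Voisin2003_smoothHypersurface_algebraicClasses_eq_top_holds`);
* `HodgeFermatVarieties_of_even` — **the crux is its even-dimensional half** `X²ᵖₘ`, `p, m ≥ 1`;
* `hodgeConjectureFor_of_claims_dim` — **per-dimension transfer**: HC for every `X` with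
  `IsFermatVariety (2p) m X` from the eigenspace structure of `H²ᵖ(X²ᵖₘ(ℂ); ℂ)` AT `(m, p)` and
  claim for the Hodge characters with `2p + 2` entries only (hypotheses `hE2`, `hE0`, `hE4`, `hB` in
  the verbatim spelling of the tree's `mem_algebraicClasses_fermat_middle_of_eigenspaces`);
* `hodgeConjectureFor_of_paired` — the same from `Shioda_claim_paired` (Aoki 1987 Thm 1-1: linear
  subspaces represent the paired characters) when every Hodge character of `X²ᵖₘ` is PAIRED;

and, CONDITIONALLY on two printed theorems — the named fact `Shioda_claim_paired` and the `(p,p)` case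
of Ran's Prop. 1.7 (ii) (Hodge types of the eigenlines), taken as the explicit hypothesis `hE4` in the
verbatim spelling used tree-wide (`= Ran1980_fermatEigenspace_hodgeType_pp` of
`Literature/…/FermatEigenspaceHodgeTypes` once that file lands) —

* `hodgeConjectureFor_of_largePrimes` (registered) — **the Hodge conjecture for every complex Fermat
  variety `Xⁿₘ` all of whose degree's prime factors exceed `n + 1`** (fourfolds: `(m, 30) = 1`;
  sixfolds: `(m, 210) = 1`; …). The arithmetic input is the landed theorem
  `PairedNull.isPaired_of_primeFactors_gt_sharp` (Aoki, Math. Ann. 266 (1983) Thm. A, direction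
  `𝔅ⁿₘ = 𝔇ⁿₘ` for `p > n + 1`, all `p ∣ m`; files `…PairedOfLargePrimes*`, ~2600 lines, sorry-free), the
  topological input the landed `stub_eigenspacePham` ((E2) ∧ (E0), Pham/Milnor).

In print this family is Shioda, Math. Ann. 245 (1979) Thm. IV with Aoki 1983 Thm. A (HC for `Xⁿₘ` when
`𝔅ⁿₘ = 𝔇ⁿₘ`, i.e. every Hodge class is a combination of classes of linear subspaces — Ran 1980 Thm. 4.9
for `m` prime).

## References

* [Aoki1983] N. Aoki, On some arithmetic problems related to the Hodge cycles on the Fermat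
  varieties, Math. Ann. 266 (1983) 23–54, Thm. A.
* [Shioda1979HodgeFermat] T. Shioda, The Hodge conjecture for Fermat varieties, Math. Ann. 245
  (1979) 175–184, Thm. I, Thm. IV.
* [Ran1980] Z. Ran, Cycles on Fermat hypersurfaces, Compositio Math. 42 (1980), Prop. 1.7, Thm. 4.9.
* [Aoki1987] N. Aoki, Some new algebraic cycles on Fermat varieties, J. Math. Soc. Japan 39 (1987),
  Thm. 1-1, Cor. 2-3.
* [VoisinHodgeII2003] C. Voisin, Hodge Theory and Complex Algebraic Geometry II, CUP 2003, §1.2.2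
  Thm. 1.23.
-/

set_option linter.dupNamespace false

noncomputable section

open CategoryTheory AlgebraicGeometry Finset
open Literature.AlgebraicGeometry Literature.AlgebraicGeometry.Motives
open Literature.AlgebraicGeometry.HodgeTheory Literature.AlgebraicGeometry.HodgeTheory.FermatCharacter
open Literature.AlgebraicTopology.SingularHomology

namespace Summit.HodgeConjecture.HodgeConjecture.Theorems.CancelByAnyClaimLattice

/-! ### Odd dimensions are unconditional; the crux is its even-dimensional half -/

/-- **HC for the ODD-dimensional Fermat varieties is UNCONDITIONAL** (no stub, no named fact): for `n`
odd every rational `(p,p)`-class of `Xⁿₘ` has `2p ≠ n`, so it is algebraic by the Lefschetz hyperplane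
theorem for smooth hypersurfaces (`Voisin2003_smoothHypersurface_algebraicClasses_eq_top_holds`,
discharged in the tree) — `algebraicClasses_fermat_eq_top_of_two_mul_ne`; the Hodge model is
`nonempty_hodgeModel_holds`; `m = 0` is the vacuous empty scheme (`degree_zero_vacuous`).
[cite: VoisinHodgeII2003, §1.2.2 Thm. 1.23] -/
theorem hodgeConjectureFor_fermat_odd ⦃n m : ℕ⦄ (hn : ¬ 2 ∣ n) ⦃X : SchemeOver ℂ⦄
    (hF : IsFermatVariety n m X) (hX : IsSmoothProjective n X) : HodgeConjectureFor n X := by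
  rcases Nat.eq_zero_or_pos m with rfl | hm
  · exact (HodgeFermatVarietiesNegative.degree_zero_vacuous hF hX).elim
  refine ⟨nonempty_hodgeModel_holds hX, fun p c _ _ ↦ ?_⟩
  rw [algebraicClasses_fermat_eq_top_of_two_mul_ne
    Voisin2003_smoothHypersurface_algebraicClasses_eq_top_holds hX hF hm (fun h ↦ hn ⟨p, h.symm⟩)]
  exact Submodule.mem_top

/-- **HC in dimension `0`** (`X⁰ₘ`, `m ≥ 1`, a finite set of points): degree `0` is
`algebraicClasses_zero`, positive degrees are off the middle. [folklore] -/
theorem hodgeConjectureFor_fermat_zero ⦃m : ℕ⦄ (hm : 0 < m) ⦃X : SchemeOver ℂ⦄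
    (hF : IsFermatVariety (2 * 0) m X) (hX : IsSmoothProjective (2 * 0) X) :
    HodgeConjectureFor (2 * 0) X := by
  refine ⟨nonempty_hodgeModel_holds hX, fun q c _ _ ↦ ?_⟩
  rcases Nat.eq_zero_or_pos q with rfl | hq
  · rw [algebraicClasses_zero]; exact Submodule.mem_top
  · rw [algebraicClasses_fermat_eq_top_of_two_mul_ne
      Voisin2003_smoothHypersurface_algebraicClasses_eq_top_holds hX hF hm (p := q) (by omega)]
    exact Submodule.mem_top

/-- **The crux is its even-dimensional half**: `HodgeFermatVarieties` follows from HC for the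
even-dimensional Fermat varieties `X²ᵖₘ`, `p ≥ 1`, `m ≥ 1` alone (odd `n`:
`hodgeConjectureFor_fermat_odd`; `n = 0`: `hodgeConjectureFor_fermat_zero`; `m = 0`: vacuous).
[folklore assembly] -/
theorem HodgeFermatVarieties_of_even
    (h : ∀ (p m : ℕ) (X : SchemeOver ℂ), 0 < p → 0 < m → IsFermatVariety (2 * p) m X →
      IsSmoothProjective (2 * p) X → HodgeConjectureFor (2 * p) X) :
    Summit.HodgeConjecture.HodgeConjecture.Theses.PadicSemiregularLift.HodgeFermatVarieties := by
  intro n m X hF hX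
  rcases Nat.eq_zero_or_pos m with rfl | hm
  · exact (HodgeFermatVarietiesNegative.degree_zero_vacuous hF hX).elim
  by_cases hn : 2 ∣ n
  · obtain ⟨p, rfl⟩ := hn
    rcases Nat.eq_zero_or_pos p with rfl | hp
    · exact hodgeConjectureFor_fermat_zero hm hF hX
    · exact h p m X hp hm hF hX
  · exact hodgeConjectureFor_fermat_odd hn hF hX

/-! ### Per-dimension transfer: one `X²ᵖₘ` at a time -/

/-- **PER-DIMENSION TRANSFER**: HC for every smooth projective `X` with `IsFermatVariety (2p) m X`,
`m ≥ 1`, `p ≥ 1`, from the eigenspace structure AT `(m, p)` and claim for the Hodge characters of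
`X²ᵖₘ` — those with `2p + 2` entries — ONLY: off the middle degree every class is algebraic by
hypersurface Lefschetz (discharged), degree `0` by `algebraicClasses_zero`, and the middle degree is
`mem_algebraicClasses_fermat_middle_of_eigenspaces` transported along
`IsFermatVariety.isoFermatHypersurface` (the per-`p` core of the tree's
`hodgeClasses_algebraic_fermat_of_claims_at`, which asks the same inputs for ALL `p`).
[cite: Shioda1979PJA, §2 Thm. 1 and p. 112] [cite: Aoki1987, Cor. 2-3 (p. 388)] -/
theorem hodgeConjectureFor_of_claims_dim {m p : ℕ} [NeZero m] (hp : 0 < p)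
    (hE2 : ∀ α : Fin (2 * p + 2) → ZMod m, α ≠ 0 → (∃ i, α i = 0) → fermatEigenspace m α (2 * p) = ⊥)
    (hE0 : fermatEigenspace m (0 : Fin (2 * p + 2) → ZMod m) (2 * p) ≤
      LinearMap.range (complexBetti.map
        (SmoothHypersurface.hypersurfaceι (fermatPolynomial ℂ (2 * p) m)) (2 * p)).hom)
    (hE4 : ∀ (A : HodgeModel (2 * p) (fermatHypersurface (2 * p) m)) (β : Fin (2 * p + 2) → ZMod m),
      (∀ i, β i ≠ 0) →
      (∃ x ∈ fermatEigenspace m β (2 * p), x ≠ 0 ∧ A.pullback (2 * p) x ∈ A.hodgePQ (2 * p) p p) →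
        2 * FermatCharacter.normSum β = m * (2 * p + 2))
    (hB : ∀ α : Fin (2 * p + 2) → ZMod m, FermatCharacter.IsHodge α → FermatCharacter.Claim m p α)
    ⦃X : SchemeOver ℂ⦄ (hF : IsFermatVariety (2 * p) m X) (hX : IsSmoothProjective (2 * p) X) :
    HodgeConjectureFor (2 * p) X := by
  have hm1 : 1 ≤ m := NeZero.one_le
  refine ⟨nonempty_hodgeModel_holds hX, fun q c hc hqq ↦ ?_⟩
  by_cases hq : 2 * q = 2 * p
  · obtain rfl : p = q := by omega
    have hX' : IsSmoothProjective (2 * p) (fermatHypersurface (2 * p) m) :=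
      isSmoothProjective_fermatHypersurface (by omega) hm1
    let e : X ≅ fermatHypersurface (2 * p) m := hF.isoFermatHypersurface
    set c' : complexBetti (fermatHypersurface (2 * p) m) (2 * p) :=
      singularCohomology.map ℂ ℂ (Motives.AlgPoints.mapContinuous (L := ℂ) e.inv) (2 * p) c with hc'
    have hc'rat : IsRationalClass c' := hc.map _
    have hc'pp : IsOfHodgeType (2 * p) (fermatHypersurface (2 * p) m) (2 * p) p p c' :=
      hqq.map_of_iso e.symm
    have hc'alg : c' ∈ algebraicClasses (fermatHypersurface (2 * p) m) p :=
      mem_algebraicClasses_fermat_middle_of_eigenspaces hp hE2 hE0 hE4 hB c' hc'rat hc'pp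
    have := mem_algebraicClasses_map_of_iso hX' hX e hc'alg
    rwa [hc', show complexBetti.map e.hom (2 * p)
        (singularCohomology.map ℂ ℂ (Motives.AlgPoints.mapContinuous (L := ℂ) e.inv) (2 * p) c) = c from
      map_hom_map_inv_apply e (2 * p) c] at this
  · rw [algebraicClasses_fermat_eq_top_of_two_mul_ne
      Voisin2003_smoothHypersurface_algebraicClasses_eq_top_holds hX hF hm1 hq]
    exact Submodule.mem_top

/-- **If every Hodge character of `X²ᵖₘ` is PAIRED then HC holds for every Fermat variety of dimension
`2p` and degree `m`**, granted Aoki's Thm 1-1 (`Shioda_claim_paired`: linear subspaces represent the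
paired characters) and the eigenspace structure at `(m, p)`. No lattice, no supply, no level change.
[cite: Ran1980, Thm. 4.9] [cite: Aoki1987, Thm. 1-1] -/
theorem hodgeConjectureFor_of_paired {m p : ℕ} [NeZero m] (hp : 0 < p) (hP : Shioda_claim_paired)
    (hE2 : ∀ α : Fin (2 * p + 2) → ZMod m, α ≠ 0 → (∃ i, α i = 0) → fermatEigenspace m α (2 * p) = ⊥)
    (hE0 : fermatEigenspace m (0 : Fin (2 * p + 2) → ZMod m) (2 * p) ≤
      LinearMap.range (complexBetti.map
        (SmoothHypersurface.hypersurfaceι (fermatPolynomial ℂ (2 * p) m)) (2 * p)).hom)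
    (hE4 : ∀ (A : HodgeModel (2 * p) (fermatHypersurface (2 * p) m)) (β : Fin (2 * p + 2) → ZMod m),
      (∀ i, β i ≠ 0) →
      (∃ x ∈ fermatEigenspace m β (2 * p), x ≠ 0 ∧ A.pullback (2 * p) x ∈ A.hodgePQ (2 * p) p p) →
        2 * FermatCharacter.normSum β = m * (2 * p + 2))
    (hpair : ∀ α : Fin (2 * p + 2) → ZMod m, FermatCharacter.IsHodge α → FermatCharacter.IsPaired α)
    ⦃X : SchemeOver ℂ⦄ (hF : IsFermatVariety (2 * p) m X) (hX : IsSmoothProjective (2 * p) X) :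
    HodgeConjectureFor (2 * p) X :=
  hodgeConjectureFor_of_claims_dim hp hE2 hE0 hE4 (fun α hα ↦ hP m p α hα.1.1 (hpair α hα)) hF hX

/-! ### The family of degrees with all prime factors `> n + 1` -/

/-- **HC FOR EVERY COMPLEX FERMAT VARIETY `Xⁿₘ` ALL OF WHOSE DEGREE'S PRIME FACTORS EXCEED `n + 1`**
(registered), modulo two printed theorems: `Shioda_claim_paired` (Aoki 1987 Thm 1-1 / Shioda 1979
Thm. I: the eigenline of a paired character is spanned by classes of linear subspaces) and the
`(p,p)` case of Ran's Prop. 1.7 (ii) (hypothesis `hE4`, verbatim `Ran1980_fermatEigenspace_hodgeType_pp`: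
a zero-free eigenline of `X²ᵖₘ` meets `H^{p,p}` only if `|β| = p + 1`). Everything else is PROVED:
odd `n` is Lefschetz (`hodgeConjectureFor_fermat_odd`), `n = 0` is points; for `n = 2p ≥ 2` the
topological eigenspace inputs (E2), (E0) are the landed `stub_eigenspacePham` (Pham/Milnor), and the
arithmetic — every Hodge character of `X²ᵖₘ` is paired as soon as every prime factor of `m` exceeds
`2p + 1` — is the landed `PairedNull.isPaired_of_primeFactors_gt_sharp` (Aoki 1983 Thm. A, direction
`𝔅 = 𝔇`; the only even prime factor candidate `2p + 2` is not prime-and-allowed, so `> 2p + 1` means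
`> 2p + 2 = R`). Fourfolds: every degree prime to `30`; sixfolds: prime to `210`.
[cite: Aoki1983, Thm. A] [cite: Shioda1979HodgeFermat, Thm. IV] [cite: Ran1980, §1 Prop. 1.7 (ii) and Thm. 4.9] -/
theorem hodgeConjectureFor_of_largePrimes : Shioda_claim_paired → (∀ (m : ℕ) [NeZero m] ⦃p : ℕ⦄, 0 < p → ∀ (A : HodgeModel (2 * p) (fermatHypersurface (2 * p) m)) (β : Fin (2 * p + 2) → ZMod m), (∀ i, β i ≠ 0) → (∃ x ∈ fermatEigenspace m β (2 * p), x ≠ 0 ∧ A.pullback (2 * p) x ∈ A.hodgePQ (2 * p) p p) → 2 * FermatCharacter.normSum β = m * (2 * p + 2)) → ∀ (n m : ℕ) [NeZero m], (∀ q ∈ m.primeFactors, n + 1 < q) → ∀ (X : SchemeOver ℂ), IsFermatVariety n m X → IsSmoothProjective n X → HodgeConjectureFor n X := by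
  intro hP hE4 n m _ hm X hF hX
  by_cases hn : 2 ∣ n
  · obtain ⟨p, rfl⟩ := hn
    rcases Nat.eq_zero_or_pos p with rfl | hp
    · exact hodgeConjectureFor_fermat_zero NeZero.one_le hF hX
    · obtain ⟨hE2, hE0⟩ := stub_eigenspacePham m hp
      refine hodgeConjectureFor_of_paired hp hP hE2 hE0 (hE4 m hp) (fun α hα ↦ ?_) hF hX
      refine PairedNull.isPaired_of_primeFactors_gt_sharp hα fun q hq ↦ ?_
      have h1 := hm q hq
      have hqP := Nat.prime_of_mem_primeFactors hq
      have hne : q ≠ 2 * p + 2 := fun h ↦ by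
        have h2 : 2 ∣ q := ⟨p + 1, by omega⟩
        rcases hqP.eq_one_or_self_of_dvd 2 h2 with h3 | h3 <;> omega
      omega
  · exact hodgeConjectureFor_fermat_odd hn hF hX

end Summit.HodgeConjecture.HodgeConjecture.Theorems.CancelByAnyClaimLattice

end
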